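import Literature.NumberTheory.LFunctions.WeilTwoPrimeOddMarginEBase
import Literature.NumberTheory.LFunctions.WeilTwoPrimeOddMarginEDataDn2
import Literature.NumberTheory.LFunctions.WeilBlockRowsPZ
import HarnessLib

/-!
# Two-prime odd-margin certificate E: the Bessel block claim `Hp = C H Cᵀ`, rows 35–39

`WeilCert.checkHpRow` for rows 35–39 of certificate E (the exact Legendre cancellation `C H Cᵀ = diag(2a₀/(4i+3))`), by `decide +kernel`. Pure proof file.
-/

noncomputable section

namespace Literature.NumberTheory.LFunctions

set_option maxHeartbeats 0 in
/-- Row 35 of `C H Cᵀ` is row 35 of `Hp` (certificate E). [folklore] -/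
theorem checkHpRow1_35_weilCert23E : weilCert23EBase.checkHpRow weilCert23EHp 1 35 = true := by
  decide +kernel

set_option maxHeartbeats 0 in
/-- Row 36 of `C H Cᵀ` is row 36 of `Hp` (certificate E). [folklore] -/
theorem checkHpRow1_36_weilCert23E : weilCert23EBase.checkHpRow weilCert23EHp 1 36 = true := by
  decide +kernel

set_option maxHeartbeats 0 in
/-- Row 37 of `C H Cᵀ` is row 37 of `Hp` (certificate E). [folklore] -/
theorem checkHpRow1_37_weilCert23E : weilCert23EBase.checkHpRow weilCert23EHp 1 37 = true := by
  decide +kernel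

set_option maxHeartbeats 0 in
/-- Row 38 of `C H Cᵀ` is row 38 of `Hp` (certificate E). [folklore] -/
theorem checkHpRow1_38_weilCert23E : weilCert23EBase.checkHpRow weilCert23EHp 1 38 = true := by
  decide +kernel

set_option maxHeartbeats 0 in
/-- Row 39 of `C H Cᵀ` is row 39 of `Hp` (certificate E). [folklore] -/
theorem checkHpRow1_39_weilCert23E : weilCert23EBase.checkHpRow weilCert23EHp 1 39 = true := by
  decide +kernel


end Literature.NumberTheory.LFunctions
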